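import Literature.Analysis.FluidPDE.VorticityDoubleConeRegularity
import Literature.Analysis.FluidPDE.AxisymmetricEuler
import HarnessLib

/-!
# Lei–Ren–Tian 2025, Proposition 6.1: near an axisymmetric singularity the fast velocity must turn axial

Topic `Analysis/FluidPDE`. Statement-only reproduction (one named fact, no proof) of the one result of
Z. Lei, X. Ren, G. Tian, *A geometric characterization of potential Navier–Stokes singularities*,
arXiv:2501.08976 [math.AP] (v1, January 2025) [LeiRenTian2025] that the accepted
`VorticityDoubleConeRegularity.lean` deliberately leaves out ("Deliberately not here: … Proposition 6.1
(direction of the velocity, axisymmetric case)"): **Proposition 6.1**, §6 "On the direction of velocity",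
arXiv p. 14, read at page level together with its proof.

## The result, as printed (arXiv p. 14)

"Proposition 6.1. Let `(v,p)` be an axisymmetric suitable weak solution to the Navier–Stokes equations in
`𝒬(1)`. If for some `δ, M > 0`, there holds either `|v| ≤ M` or `|v/|v| · e₃| ≤ 1 − δ`, then `v` is
regular at the origin."

Proof given there (six lines): the condition is equivalent to `|v_z| ≤ C (1 + |v_θ| + |v_r|)`; with the
Stokes stream function `∂_r ψ = r v_z`, `∂_z ψ = −r v_r`, `ψ|_{r=0} = 0` and the boundedness of
`Γ = r v_θ` for local axisymmetric suitable weak solutions ([LR] = Lei–Ren, Adv. Math. 445 (2024)) this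
gives `|∂_r ψ| ≤ C₁ + C₂ |∂_z ψ|`; an exploration along level sets of `ψ` down to the axis yields
`|ψ(r, z)| ≤ 3 C₁ r`, "a critical estimate [LZ]" (Lei–Zhang, J. Funct. Anal. 261 (2011); tree:
`LeiZhang2011_regularity_bmoStream`, the case `B = (ψ/r) e_θ ∈ L^∞ ⊆ BMO`), "and as a consequence,
[v] must be regular near the origin". The authors add (p. 14, before the proposition): "The extension of
Proposition 6.1 to the general non-axisymmetric case would imply that near a potential singularity, the
range of `± v/|v|` is dense on the unit sphere" — that extension is NOT claimed in the paper and is not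
recorded here. Read contrapositively the proposition says: at an axisymmetric singular point there are
regular points with `|v| → ∞` along which `|v_z| / (1 + |v_r| + |v_θ|) → ∞` (an axial jet).

## Transcription into the tree's vocabulary (the conventions of `VorticityDoubleConeRegularity.lean`)

* Space–time is `ℝ × ℝ³`, **time first**, `ℝ³ = EuclideanSpace ℝ (Fin 3)`, the axis of symmetry is the
  `x 2`-axis (`rotZ`, `IsAxisymmetric`, `IsAxisymmetricScalar` of `AxisymmetricEuler.lean`), `e₃ · v = v 2`.
* "Suitable weak solution to the Navier–Stokes equations in the unit parabolic ball" (the paper's §2.1,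
  (2.1)–(2.2): unit viscosity, no force) is the accepted `IsSuitableWeakSolutionInBall 1 0 u p`
  (`LocalTypeI.lean`), exactly as for Theorem 1.1 (`LeiRenTian2025_doubleCone_regularity`).
* "Regular at the origin" / "regular point" is the backward notion of the paper's footnote 1,
  `¬ IsBackwardSingularPoint u z` (`u` essentially bounded on some `Q(z, r)`, `r > 0`;
  `not_isBackwardSingularPoint_iff`).
* ROUND VERSUS FLAT CYLINDERS. The proposition is printed for the flat cylinder
  `𝒬(1) = {|x_h| < 1, |x₃| < 1} × (−1, 0)`, which the tree does not carry; §2 of the paper (first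
  paragraph, p. 6) records that `B(r), Q(r)` and `𝓑(r), 𝒬(r)` replace each other in the statements
  "without changing their strength at all". We impose the hypotheses on the ROUND unit cylinder
  `Q(1) = parabolicCylinder 1 0 = (−1, 0) × B_1(0)`. This is implied by the printed statement: since
  `𝒬(1/√2) ⊆ Q(1)`, a solution satisfying the hypotheses in `Q(1)` satisfies them in `𝒬(1/√2)`, and the
  Navier–Stokes scaling `v_λ(x,t) = λ v(λx, λ²t)`, `λ = 1/√2`, turns it into one satisfying them in `𝒬(1)`
  with `M` replaced by `λM` (the direction condition, axisymmetry, the suitable class and the regularity of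
  the origin are scale invariant); the printed proposition then gives regularity of `v_λ`, hence of `v`, at
  the origin.
* AXISYMMETRY is imposed pointwise on the representative: `IsAxisymmetric (u t)` and
  `IsAxisymmetricScalar (p t)` for every `t ∈ (−1, 0)` (KNSS 2009, (1.5)). This is stronger than any
  almost-everywhere formulation, so the recorded fact is at most weaker than print.
* REPRESENTATIVE. As in Theorem 1.1 the hypothesis is a pointwise condition at regular points, so the
  standing convention `LeiRenTian2025.IsClassicalAtRegularPoints u (Q(1))` (joint continuity and spatial
  differentiability at every regular point — true for the canonical representative, smooth on the regular
  set) is carried over verbatim from `VorticityDoubleConeRegularity.lean`; without it a pointwise velocity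
  condition on an arbitrary representative would be vacuous (see that file's module docstring).
* The direction condition is written division-free: `|v 2| ≤ (1 − δ) ‖v‖`, which for `v ≠ 0` is the printed
  `|v/|v| · e₃| = |v 2| / ‖v‖ ≤ 1 − δ` (`abs_apply_two_div_norm_le_iff`) and for `v = 0` holds trivially
  (there `|v| ≤ M` holds anyway).

## Deliberately not here

The proof (the level-set exploration and the appeal to [LZ]); the lemma "[LR]: `Γ = r v_θ` is bounded for
local axisymmetric suitable weak solutions"; the non-axisymmetric extension (explicitly open, p. 14);
Theorem 1.1 and Corollaries 1.5–1.6 (already in `VorticityDoubleConeRegularity.lean`).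

## Mathlib / tree search

`lean search 'velocityDirection|Proposition 6.1|LeiRenTian2025_velocity'` and a read of
`VorticityDoubleConeRegularity.lean` (2026-08-18): Prop. 6.1 is not in the tree. Reused: `parabolicCylinder`,
`IsSuitableWeakSolutionInBall`, `IsBackwardSingularPoint`, `LeiRenTian2025.IsClassicalAtRegularPoints`,
`IsAxisymmetric`, `IsAxisymmetricScalar`.

## References

* Z. Lei, X. Ren, G. Tian, *A geometric characterization of potential Navier–Stokes singularities*,
  arXiv:2501.08976 [math.AP] (2025): Prop. 6.1 and its proof, §6, p. 14; §2 first paragraph and §2.1,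
  p. 6; footnote 1, p. 4. [LeiRenTian2025]
* Z. Lei, Q. S. Zhang, *A Liouville theorem for the axially-symmetric Navier–Stokes equations*,
  J. Funct. Anal. 261 (2011) 2323–2345 = arXiv:1011.5066, Thm. 1.4. [LeiZhang2011]
* Z. Lei, X. Ren, *Quantitative partial regularity of the Navier–Stokes equations and applications*,
  Adv. Math. 445 (2024) 109654. [LeiRen2024]
* D. Albritton, T. Barker, J. Math. Fluid Mech. 21 (2019), Def. 2.1, §1. [AlbrittonBarker2019]
-/

noncomputable section

open MeasureTheory Set Function Metric
open scoped InnerProductSpace RealInnerProductSpace ENNReal NNReal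

namespace Literature.Analysis.FluidPDE

/-- Local notation for physical space `ℝ³ = EuclideanSpace ℝ (Fin 3)`. -/
local notation "ℝ³" => EuclideanSpace ℝ (Fin 3)

/-- The division-free form of the velocity-direction condition of Lei–Ren–Tian 2025, Prop. 6.1: for
`v ≠ 0`, `|v/|v| · e₃| ≤ 1 − δ` (printed) iff `|v 2| ≤ (1 − δ) ‖v‖` (recorded), since
`v/|v| · e₃ = v 2 / ‖v‖`. [folklore] -/
theorem abs_apply_two_div_norm_le_iff {v : ℝ³} (hv : v ≠ 0) (δ : ℝ) :
    |v 2| / ‖v‖ ≤ 1 - δ ↔ |v 2| ≤ (1 - δ) * ‖v‖ := by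
  rw [div_le_iff₀ (norm_pos_iff.mpr hv)]

/-- **Lei–Ren–Tian 2025, Proposition 6.1 (axisymmetric case: a velocity-direction cone away from the
axis of symmetry forces regularity).** Let `(u, p)` be a suitable weak solution of the unforced
Navier–Stokes equations (`ν = 1`) in the unit parabolic ball `Q(1) = (−1, 0) × B_1(0)`
(`IsSuitableWeakSolutionInBall 1 0 u p`), axisymmetric about the `x 2`-axis at every time `t ∈ (−1, 0)`
(`IsAxisymmetric (u t)`, `IsAxisymmetricScalar (p t)`), represented canonically at its regular points
(`LeiRenTian2025.IsClassicalAtRegularPoints`). Suppose there are `δ > 0` and `M > 0` such that at every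
regular point `(t, x) ∈ Q(1)` (backward sense) either `|u(t,x)| ≤ M` or `|u(t,x) · e₃| ≤ (1 − δ) |u(t,x)|`
(printed: `|u/|u| · e₃| ≤ 1 − δ`), i.e. wherever the velocity is large it stays outside the double cone of
half-angle `arccos (1 − δ)` around the axis direction `±e₃`. Then the origin is a regular point of `u`
(backward sense: `u` is essentially bounded on some `Q(0, r)`, `r > 0`). The printed flat cylinder `𝒬(1)`
is replaced by the round `Q(1) ⊇ 𝒬(1/√2)`, which by the Navier–Stokes scaling yields a statement implied
by the printed one (module docstring). Users take it as a hypothesis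
`(h : LeiRenTian2025_velocityDirection_axisymmetric)`.
[cite: LeiRenTian2025, Prop. 6.1 (arXiv:2501.08976, §6, p. 14)] -/
def LeiRenTian2025_velocityDirection_axisymmetric : Prop :=
  ∀ (u : ℝ → ℝ³ → ℝ³) (p : ℝ → ℝ³ → ℝ) (δ M : ℝ),
    IsSuitableWeakSolutionInBall 1 0 u p →
    LeiRenTian2025.IsClassicalAtRegularPoints u (parabolicCylinder 1 (0 : ℝ × ℝ³)) →
    (∀ t ∈ Ioo (-1 : ℝ) 0, IsAxisymmetric (u t)) →
    (∀ t ∈ Ioo (-1 : ℝ) 0, IsAxisymmetricScalar (p t)) →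
    0 < δ → 0 < M →
    (∀ z ∈ parabolicCylinder 1 (0 : ℝ × ℝ³), ¬ IsBackwardSingularPoint u z →
      ‖u z.1 z.2‖ ≤ M ∨ |u z.1 z.2 2| ≤ (1 - δ) * ‖u z.1 z.2‖) →
    ¬ IsBackwardSingularPoint u (0 : ℝ × ℝ³)

end Literature.Analysis.FluidPDE

end
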